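import Literature.AnabelianGeometry.SemiGraphs.TemperedAnabelianThm68ivSub
import Literature.AnabelianGeometry.SemiGraphs.TemperedAnabelianThm68SubProofs2
import Literature.AnabelianGeometry.SemiGraphs.TemperedDLocTypeTransportLemmas

/-!
# [SemiAnbd] Thm. 6.8 (iv) re-cut, proof plumbing I: realising transported arrows ON THE NOSE

Mochizuki, *Semi-graphs of anabelioids* [SemiAnbd], §6 Thm. 6.8 (ii)/(iv), ms. pp. 74–75; printed mechanism
= [Mzk8] = [GalSect] Thm. 2.3 / Cor. 2.5 / Rmk. 2.8.1 (ms. pp. 9, 12): «by transporting … via the equivalences of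
Theorem 2.3, (i), and applying Theorem 1.3, (ii), (iii)». [cite: MochizukiSemiAnbd2006, Thm 6.8 pp.74-75]
[cite: MochizukiGalSect2005, Rmk 2.8.1 p.12]

Proof-only companion (abc-iut cell, layer L3, seat abc-iut-L3-t7; row «Q-IV·TRIPOD-DESCENT», sub-DAG re-cut
of Thm. 6.8 (iv) typed in `TemperedAnabelianThm68ivSub.lean`).  Reusable bookkeeping, over abc-iut-L3-t4's
genuine-morphism category and transport (`TemperedDLocCategory.lean`, `TemperedDLocTransport.lean`) and the
w5-d040 lemmas (`TemperedDLocTypeTransportLemmas.lean`), for an isomorphism `α : Π^temp_{X_K} ⥲ Π^temp_{Y_L}`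
under (hI) = Thm. 6.5 (iii) for cuspidal geometric decomposition groups and (hΔ):
* for an object `P` of `DLoc_K(X_K)` and an object `P'` of `DLoc_L(Y_L)` realising the transport of `π₁(P)` ON
  THE NOSE (`H`, `N` equal), the isomorphism `θ_P : Π^temp(Z_P) ⥲ Π^temp(Z_{P'})` (passed as data with its defining equation; no definition is introduced) and
  its bookkeeping (`theta_objIso_proj`; for `P = X_K`, `selfIso ∘ θ = α ∘ selfIso`, `selfIso_theta`);
* for an arrow `χ : P → Q` of `DLoc_K(X_K)`, the CHOSEN representative `ρ` of its transport between the
  on-the-nose realisations (characterised by its values) and, by fullness of the tempered-π₁ functor of `Y_L`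
  (Thm. 6.8 (i)), a realising arrow `χ' : P' → Q'` (`exists_realized`), with `π₁(χ') ∘ θ_P = Inn ∘ θ_Q ∘ π₁(χ)`
  (`pi1_realized_conj`);
* `π₁(f ≫ g) = Inn ∘ π₁(g) ∘ π₁(f)` inside one `DLocSchemeData` (`pi1_comp_conj`);
* injectivity / surjectivity / open image of finite index of `ρ` from the same for the original
  representative (`rep_injective`, `rep_surjective`, `rep_range`, `rep_range_open_finiteIndex`); the OF-type
  clause (T68-R1) and the witness transport are in the companion `…Thm68ivTransport.lean`.
Nothing of [SemiAnbd]/[GalSect] is asserted; nothing here takes a side on [IUTchIII] Cor. 3.12.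
-/

noncomputable section

namespace Literature.AnabelianGeometry.SemiGraphs

open scoped Pointwise
open CategoryTheory Topology

variable {p : ℕ} [Fact p.Prime]

namespace Thm68Sub

/-! ### `π₁` of a composite, inside one `DLocSchemeData` -/

section Comp

variable {X : TemperedCurve p} (D : DLocSchemeData X)

/-- `π₁(f ≫ g)` agrees with `π₁(g) ∘ π₁(f)` up to an inner automorphism (functoriality of the tempered
fundamental group functor, read through `DLocSchemeData.map_objIso`). [cite: MochizukiSemiAnbd2006, §6 p.74] -/
theorem pi1_comp_conj {P Q R : D.DLocK} (f : letI := D.catK; P ⟶ Q) (g : letI := D.catK; Q ⟶ R) :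
    letI := D.catK
    ∃ k : (D.curve R).PiTemp, ∀ d : (D.curve P).PiTemp,
      D.pi1 (f ≫ g) d = k * D.pi1 g (D.pi1 f d) * k⁻¹ := by
  letI := D.catK; letI := DLocObj.dlocCategory X
  obtain ⟨φf, hφf, cf, hcf⟩ := D.map_objIso f
  obtain ⟨φg, hφg, cg, hcg⟩ := D.map_objIso g
  obtain ⟨φc, hφc, cc, hcc⟩ := D.map_objIso (f ≫ g)
  have hcomp : D.pi1Functor.map (f ≫ g) = DLocObj.homMk (φg.comp φf) := by
    rw [Functor.map_comp, hφf, hφg, homMk_comp_homMk]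
  obtain ⟨b, hb⟩ := exists_conj_of_homMk_eq (hφc.symm.trans hcomp)
  -- `hb : ∀ j, (φg.comp φf) j = b * φc j * b⁻¹`
  refine ⟨cc⁻¹ * (D.objIso R b)⁻¹ * cg * D.pi1 g cf, fun d => ?_⟩
  have h1 := hcc ((D.objIso P).symm d)
  rw [ContinuousMulEquiv.apply_symm_apply] at h1
  -- `h1 : objIso R (φc j) = cc * pi1 (f ≫ g) d * cc⁻¹`
  have h2 : D.pi1 (f ≫ g) d = cc⁻¹ * D.objIso R (φc.toHom ((D.objIso P).symm d)) * cc := by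
    rw [h1]; group
  have h3 : φc.toHom ((D.objIso P).symm d) = b⁻¹ * (φg.comp φf).toHom ((D.objIso P).symm d) * b := by
    rw [hb]; group
  have h4 : (φg.comp φf).toHom ((D.objIso P).symm d) = φg.toHom (φf.toHom ((D.objIso P).symm d)) := rfl
  have h5 := hcf ((D.objIso P).symm d)
  rw [ContinuousMulEquiv.apply_symm_apply] at h5
  -- `h5 : objIso Q (φf j) = cf * pi1 f d * cf⁻¹`
  have h6 := hcg ((D.objIso Q).symm (D.objIso Q (φf.toHom ((D.objIso P).symm d))))
  rw [ContinuousMulEquiv.apply_symm_apply, ContinuousMulEquiv.symm_apply_apply] at h6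
  -- `h6 : objIso R (φg (φf j)) = cg * pi1 g (objIso Q (φf j)) * cg⁻¹`
  rw [h2, h3, h4, map_mul, map_mul, map_inv, h6, h5, map_mul, map_mul, map_inv]
  group

end Comp

/-! ### On-the-nose realisations and the isomorphisms `θ_P`

No definitions are introduced (proof-only file): the isomorphism
`θ_P : Π^temp(Z_P) ≅ J_P ⥲ J_{P^α} = J_{P'} ≅ Π^temp(Z_{P'})` and the chosen transported representative
`ρ : J_{P'} ⥲ J_{P^α} → J_{Q^α} ⥲ J_{Q'}` are passed as data CHARACTERISED by their defining equations
(`hθ…`, `hρ`); the consumer builds them as the displayed composites and discharges the equations by `rfl`. -/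

section Realize

variable {X Y : TemperedCurve p} (DXs : DLocSchemeData X) (DYs : DLocSchemeData Y)
  (α : X.PiTemp ≃ₜ* Y.PiTemp)
  (hI : ∀ I : Subgroup X.PiTemp, X.IsCuspidalGeometricDecompositionGroup I →
    Y.IsCuspidalGeometricDecompositionGroup (I.map α.toMulEquiv.toMonoidHom))
  (hΔ : X.DeltaTemp.map α.toMulEquiv.toMonoidHom = Y.DeltaTemp)

/-- `θ_P` on the class of `h ∈ H_P` (through `objIso`) is the class of `α(h) ∈ H_{P'}` (through `objIso`).
[cite: MochizukiSemiAnbd2006, Thm 6.8(ii) p.74] -/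
theorem theta_objIso_proj (P : DXs.DLocK) (P' : DYs.DLocK)
    (hH : letI := DXs.catK; letI := DYs.catK; letI := DLocObj.dlocCategory X; letI := DLocObj.dlocCategory Y;
      (DYs.pi1Functor.obj P').H = ((DXs.pi1Functor.obj P).transport α hI hΔ).H)
    (hN : letI := DXs.catK; letI := DYs.catK; letI := DLocObj.dlocCategory X; letI := DLocObj.dlocCategory Y;
      (DYs.pi1Functor.obj P').N = ((DXs.pi1Functor.obj P).transport α hI hΔ).N)
    (θ : (DXs.curve P).PiTemp ≃ₜ* (DYs.curve P').PiTemp)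
    (hθ : letI := DXs.catK; letI := DYs.catK; letI := DLocObj.dlocCategory X; letI := DLocObj.dlocCategory Y;
      ∀ j, θ (DXs.objIso P j) =
        DYs.objIso P' ((jEquivOfEq _ _ hH hN).symm (DLocObj.jIso α hI hΔ (DXs.pi1Functor.obj P) j)))
    (h : letI := DXs.catK; letI := DLocObj.dlocCategory X; (DXs.pi1Functor.obj P).H) :
    letI := DXs.catK; letI := DYs.catK; letI := DLocObj.dlocCategory X; letI := DLocObj.dlocCategory Y
    θ (DXs.objIso P ((DXs.pi1Functor.obj P).proj h)) =
      DYs.objIso P' ((DYs.pi1Functor.obj P').proj ⟨α (h : X.PiTemp), by rw [hH]; exact ⟨h, h.2, rfl⟩⟩) := by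
  letI := DXs.catK; letI := DYs.catK; letI := DLocObj.dlocCategory X; letI := DLocObj.dlocCategory Y
  rw [hθ]
  congr 1

/-- For the objects `X_K`, `Y_L` themselves (`H = Π^temp`, no cusp filled): `selfIso_Y ∘ θ = α ∘ selfIso_X`.
[cite: MochizukiSemiAnbd2006, Thm 6.8(ii) p.74] -/
theorem selfIso_theta
    (hH : letI := DXs.catK; letI := DYs.catK; letI := DLocObj.dlocCategory X; letI := DLocObj.dlocCategory Y;
      (DYs.pi1Functor.obj DYs.self).H = ((DXs.pi1Functor.obj DXs.self).transport α hI hΔ).H)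
    (hN : letI := DXs.catK; letI := DYs.catK; letI := DLocObj.dlocCategory X; letI := DLocObj.dlocCategory Y;
      (DYs.pi1Functor.obj DYs.self).N = ((DXs.pi1Functor.obj DXs.self).transport α hI hΔ).N)
    (θ : (DXs.curve DXs.self).PiTemp ≃ₜ* (DYs.curve DYs.self).PiTemp)
    (hθ : letI := DXs.catK; letI := DYs.catK; letI := DLocObj.dlocCategory X; letI := DLocObj.dlocCategory Y;
      ∀ j, θ (DXs.objIso DXs.self j) =
        DYs.objIso DYs.self ((jEquivOfEq _ _ hH hN).symm (DLocObj.jIso α hI hΔ (DXs.pi1Functor.obj DXs.self) j)))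
    (q : (DXs.curve DXs.self).PiTemp) :
    DYs.selfIso (θ q) = α (DXs.selfIso q) := by
  letI := DXs.catK; letI := DYs.catK; letI := DLocObj.dlocCategory X; letI := DLocObj.dlocCategory Y
  obtain ⟨j, rfl⟩ := (DXs.objIso DXs.self).surjective q
  obtain ⟨h, rfl⟩ := QuotientGroup.mk_surjective j
  have h1 := theta_objIso_proj DXs DYs α hI hΔ DXs.self DYs.self hH hN θ hθ h
  change θ (DXs.objIso DXs.self (QuotientGroup.mk h)) = _ at h1
  rw [h1, DYs.selfIso_objIso]
  change α (h : X.PiTemp) = α (DXs.selfIso (DXs.objIso DXs.self ((DXs.pi1Functor.obj DXs.self).proj h)))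
  rw [DXs.selfIso_objIso]

/-! ### The chosen representative of a transported arrow and its realisation -/

/-- `jEquivOfEq⁻¹` lies over `G_K` (for `DLocObj.HomRep.ofEquiv`). [cite: MochizukiSemiAnbd2006, §6 p.74] -/
theorem augJ_jEquivOfEq_symm (A B : DLocObj Y) (hH : A.H = B.H) (hN : A.N = B.N) (j : B.J) :
    A.augJ ((jEquivOfEq A B hH hN).symm j) = B.augJ j := by
  have := augJ_jEquivOfEq A B hH hN ((jEquivOfEq A B hH hN).symm j)
  rw [ContinuousMulEquiv.apply_symm_apply] at this
  exact this.symm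

/-- Realising the transported arrow (fullness of the tempered-π₁ functor of `Y_L`, Thm. 6.8 (i)): there are a
representative `ρ : J_{P'} ⥲ J_{P^α} → J_{Q^α} ⥲ J_{Q'}` of the transport of `φ` between the on-the-nose
realisations (characterised by its values) and an arrow `χ' : P' → Q'` whose image under the functor is its class.
[cite: MochizukiSemiAnbd2006, Thm 6.8(i) p.74] -/
theorem exists_realized (hFull : PiFunctorFull Y DYs) {P Q : DXs.DLocK} {P' Q' : DYs.DLocK}
    (hHP : letI := DXs.catK; letI := DYs.catK; letI := DLocObj.dlocCategory X; letI := DLocObj.dlocCategory Y;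
      (DYs.pi1Functor.obj P').H = ((DXs.pi1Functor.obj P).transport α hI hΔ).H)
    (hNP : letI := DXs.catK; letI := DYs.catK; letI := DLocObj.dlocCategory X; letI := DLocObj.dlocCategory Y;
      (DYs.pi1Functor.obj P').N = ((DXs.pi1Functor.obj P).transport α hI hΔ).N)
    (hHQ : letI := DXs.catK; letI := DYs.catK; letI := DLocObj.dlocCategory X; letI := DLocObj.dlocCategory Y;
      (DYs.pi1Functor.obj Q').H = ((DXs.pi1Functor.obj Q).transport α hI hΔ).H)
    (hNQ : letI := DXs.catK; letI := DYs.catK; letI := DLocObj.dlocCategory X; letI := DLocObj.dlocCategory Y;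
      (DYs.pi1Functor.obj Q').N = ((DXs.pi1Functor.obj Q).transport α hI hΔ).N)
    (φ : letI := DXs.catK; letI := DLocObj.dlocCategory X;
      DLocObj.HomRep (DXs.pi1Functor.obj P) (DXs.pi1Functor.obj Q)) :
    letI := DXs.catK; letI := DYs.catK; letI := DLocObj.dlocCategory X; letI := DLocObj.dlocCategory Y
    ∃ (ρ : DLocObj.HomRep (DYs.pi1Functor.obj P') (DYs.pi1Functor.obj Q')) (χ' : P' ⟶ Q'),
      (∀ j', ρ.toHom j' = (jEquivOfEq _ _ hHQ hNQ).symm (DLocObj.jIso α hI hΔ _ (φ.toHom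
        ((DLocObj.jIso α hI hΔ _).symm (jEquivOfEq _ _ hHP hNP j'))))) ∧
      DYs.pi1Functor.map χ' = DLocObj.homMk ρ := by
  letI := DXs.catK; letI := DYs.catK; letI := DLocObj.dlocCategory X; letI := DLocObj.dlocCategory Y
  let ρ : DLocObj.HomRep (DYs.pi1Functor.obj P') (DYs.pi1Functor.obj Q') :=
    (DLocObj.HomRep.ofEquiv (jEquivOfEq _ _ hHQ hNQ).symm (augJ_jEquivOfEq_symm _ _ hHQ hNQ)).comp
      ((φ.transport α hI hΔ).comp
        (DLocObj.HomRep.ofEquiv (jEquivOfEq _ _ hHP hNP) (augJ_jEquivOfEq _ _ hHP hNP)))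
  obtain ⟨χ', hχ'⟩ := hFull.map_surjective (DLocObj.homMk ρ : DYs.pi1Functor.obj P' ⟶ DYs.pi1Functor.obj Q')
  exact ⟨ρ, χ', fun j' => rfl, hχ'⟩

/-- **`π₁(χ') ∘ θ_P = Inn ∘ θ_Q ∘ π₁(χ)`** for an arrow `χ : P → Q`, a representative `φ` compatible with `π₁(χ)`
as in `DLocSchemeData.map_objIso` (only this compatibility `hc` is used), and a realisation `χ'` of the transported
representative `ρ`. [cite: MochizukiSemiAnbd2006, Thm 6.8(ii) p.74] -/
theorem pi1_realized_conj {P Q : DXs.DLocK} {P' Q' : DYs.DLocK}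
    (hHP : letI := DXs.catK; letI := DYs.catK; letI := DLocObj.dlocCategory X; letI := DLocObj.dlocCategory Y;
      (DYs.pi1Functor.obj P').H = ((DXs.pi1Functor.obj P).transport α hI hΔ).H)
    (hNP : letI := DXs.catK; letI := DYs.catK; letI := DLocObj.dlocCategory X; letI := DLocObj.dlocCategory Y;
      (DYs.pi1Functor.obj P').N = ((DXs.pi1Functor.obj P).transport α hI hΔ).N)
    (hHQ : letI := DXs.catK; letI := DYs.catK; letI := DLocObj.dlocCategory X; letI := DLocObj.dlocCategory Y;
      (DYs.pi1Functor.obj Q').H = ((DXs.pi1Functor.obj Q).transport α hI hΔ).H)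
    (hNQ : letI := DXs.catK; letI := DYs.catK; letI := DLocObj.dlocCategory X; letI := DLocObj.dlocCategory Y;
      (DYs.pi1Functor.obj Q').N = ((DXs.pi1Functor.obj Q).transport α hI hΔ).N)
    (θP : (DXs.curve P).PiTemp ≃ₜ* (DYs.curve P').PiTemp)
    (hθP : letI := DXs.catK; letI := DYs.catK; letI := DLocObj.dlocCategory X; letI := DLocObj.dlocCategory Y;
      ∀ j, θP (DXs.objIso P j) =
        DYs.objIso P' ((jEquivOfEq _ _ hHP hNP).symm (DLocObj.jIso α hI hΔ (DXs.pi1Functor.obj P) j)))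
    (θQ : (DXs.curve Q).PiTemp ≃ₜ* (DYs.curve Q').PiTemp)
    (hθQ : letI := DXs.catK; letI := DYs.catK; letI := DLocObj.dlocCategory X; letI := DLocObj.dlocCategory Y;
      ∀ j, θQ (DXs.objIso Q j) =
        DYs.objIso Q' ((jEquivOfEq _ _ hHQ hNQ).symm (DLocObj.jIso α hI hΔ (DXs.pi1Functor.obj Q) j)))
    {χ : letI := DXs.catK; P ⟶ Q}
    {φ : letI := DXs.catK; letI := DLocObj.dlocCategory X;
      DLocObj.HomRep (DXs.pi1Functor.obj P) (DXs.pi1Functor.obj Q)}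
    {c : (DXs.curve Q).PiTemp}
    (hc : letI := DXs.catK; letI := DLocObj.dlocCategory X;
      ∀ j, DXs.objIso Q (φ.toHom j) = c * DXs.pi1 χ (DXs.objIso P j) * c⁻¹)
    {ρ : letI := DYs.catK; letI := DLocObj.dlocCategory Y;
      DLocObj.HomRep (DYs.pi1Functor.obj P') (DYs.pi1Functor.obj Q')}
    (hρ : letI := DXs.catK; letI := DYs.catK; letI := DLocObj.dlocCategory X; letI := DLocObj.dlocCategory Y;
      ∀ j', ρ.toHom j' = (jEquivOfEq _ _ hHQ hNQ).symm (DLocObj.jIso α hI hΔ _ (φ.toHom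
        ((DLocObj.jIso α hI hΔ _).symm (jEquivOfEq _ _ hHP hNP j')))))
    {χ' : letI := DYs.catK; P' ⟶ Q'}
    (hχ' : letI := DYs.catK; letI := DLocObj.dlocCategory Y; DYs.pi1Functor.map χ' = DLocObj.homMk ρ) :
    ∃ k : (DYs.curve Q').PiTemp, ∀ d : (DXs.curve P).PiTemp,
      DYs.pi1 χ' (θP d) = k * θQ (DXs.pi1 χ d) * k⁻¹ := by
  letI := DXs.catK; letI := DYs.catK; letI := DLocObj.dlocCategory X; letI := DLocObj.dlocCategory Y
  obtain ⟨φ', hφ', c', hc'⟩ := DYs.map_objIso χ'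
  obtain ⟨b, hb⟩ := exists_conj_of_homMk_eq (hφ'.symm.trans hχ')
  -- `hb : ∀ j', ρ j' = b * φ' j' * b⁻¹`
  refine ⟨c'⁻¹ * (DYs.objIso Q' b)⁻¹ * θQ c, fun d => ?_⟩
  -- `j'` with `objIso P' j' = θ_P d`
  set j' : (DYs.pi1Functor.obj P').J := (jEquivOfEq _ _ hHP hNP).symm
    (DLocObj.jIso α hI hΔ _ ((DXs.objIso P).symm d)) with hj'
  have hθd : θP d = DYs.objIso P' j' := by
    have := hθP ((DXs.objIso P).symm d)
    rwa [ContinuousMulEquiv.apply_symm_apply] at this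
  have h1 := hc' j'
  have h2 : DYs.pi1 χ' (DYs.objIso P' j') = c'⁻¹ * DYs.objIso Q' (φ'.toHom j') * c' := by
    rw [h1]; group
  have h3 : φ'.toHom j' = b⁻¹ * ρ.toHom j' * b := by
    rw [hb]; group
  have h4 : ρ.toHom j' =
      (jEquivOfEq _ _ hHQ hNQ).symm (DLocObj.jIso α hI hΔ _ (φ.toHom ((DXs.objIso P).symm d))) := by
    rw [hρ, hj', ContinuousMulEquiv.apply_symm_apply, ContinuousMulEquiv.symm_apply_apply]
  have h5 : φ.toHom ((DXs.objIso P).symm d) = (DXs.objIso Q).symm (c * DXs.pi1 χ d * c⁻¹) := by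
    rw [ContinuousMulEquiv.eq_symm_apply]
    have := hc ((DXs.objIso P).symm d)
    rwa [ContinuousMulEquiv.apply_symm_apply] at this
  have h6 : ∀ q : (DXs.curve Q).PiTemp, DYs.objIso Q' ((jEquivOfEq _ _ hHQ hNQ).symm
      (DLocObj.jIso α hI hΔ _ ((DXs.objIso Q).symm q))) = θQ q := by
    intro q
    have := hθQ ((DXs.objIso Q).symm q)
    rw [ContinuousMulEquiv.apply_symm_apply] at this
    exact this.symm
  rw [hθd, h2, h3, h4, h5, map_mul, map_mul, map_inv, h6, map_mul, map_mul, map_inv]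
  group

/-! ### Properties of the chosen representative -/

section RepProps

variable {P Q : DXs.DLocK} {P' Q' : DYs.DLocK}
  (hHP : letI := DXs.catK; letI := DYs.catK; letI := DLocObj.dlocCategory X; letI := DLocObj.dlocCategory Y;
    (DYs.pi1Functor.obj P').H = ((DXs.pi1Functor.obj P).transport α hI hΔ).H)
  (hNP : letI := DXs.catK; letI := DYs.catK; letI := DLocObj.dlocCategory X; letI := DLocObj.dlocCategory Y;
    (DYs.pi1Functor.obj P').N = ((DXs.pi1Functor.obj P).transport α hI hΔ).N)
  (hHQ : letI := DXs.catK; letI := DYs.catK; letI := DLocObj.dlocCategory X; letI := DLocObj.dlocCategory Y;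
    (DYs.pi1Functor.obj Q').H = ((DXs.pi1Functor.obj Q).transport α hI hΔ).H)
  (hNQ : letI := DXs.catK; letI := DYs.catK; letI := DLocObj.dlocCategory X; letI := DLocObj.dlocCategory Y;
    (DYs.pi1Functor.obj Q').N = ((DXs.pi1Functor.obj Q).transport α hI hΔ).N)
  {φ : letI := DXs.catK; letI := DLocObj.dlocCategory X;
    DLocObj.HomRep (DXs.pi1Functor.obj P) (DXs.pi1Functor.obj Q)}
  {ρ : letI := DYs.catK; letI := DLocObj.dlocCategory Y;
    DLocObj.HomRep (DYs.pi1Functor.obj P') (DYs.pi1Functor.obj Q')}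
  (hρ : letI := DXs.catK; letI := DYs.catK; letI := DLocObj.dlocCategory X; letI := DLocObj.dlocCategory Y;
    ∀ j', ρ.toHom j' = (jEquivOfEq _ _ hHQ hNQ).symm (DLocObj.jIso α hI hΔ _ (φ.toHom
      ((DLocObj.jIso α hI hΔ _).symm (jEquivOfEq _ _ hHP hNP j')))))

include hρ

/-- `ρ` is injective if `φ` is. [cite: MochizukiSemiAnbd2006, Thm 6.8(ii) p.74] -/
theorem rep_injective (h : Function.Injective φ.toHom) : Function.Injective ρ.toHom := by
  letI := DXs.catK; letI := DYs.catK; letI := DLocObj.dlocCategory X; letI := DLocObj.dlocCategory Y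
  intro a b hab
  rw [hρ, hρ] at hab
  have := h ((DLocObj.jIso α hI hΔ _).injective ((jEquivOfEq _ _ hHQ hNQ).symm.injective hab))
  exact (jEquivOfEq _ _ hHP hNP).injective ((DLocObj.jIso α hI hΔ _).symm.injective this)

/-- `ρ` is surjective if `φ` is. [cite: MochizukiSemiAnbd2006, Thm 6.8(ii) p.74] -/
theorem rep_surjective (h : Function.Surjective φ.toHom) : Function.Surjective ρ.toHom := by
  letI := DXs.catK; letI := DYs.catK; letI := DLocObj.dlocCategory X; letI := DLocObj.dlocCategory Y
  intro y
  obtain ⟨x, hx⟩ := h ((DLocObj.jIso α hI hΔ _).symm (jEquivOfEq _ _ hHQ hNQ y))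
  refine ⟨(jEquivOfEq _ _ hHP hNP).symm (DLocObj.jIso α hI hΔ _ x), ?_⟩
  rw [hρ, ContinuousMulEquiv.apply_symm_apply, ContinuousMulEquiv.symm_apply_apply, hx,
    ContinuousMulEquiv.apply_symm_apply, ContinuousMulEquiv.symm_apply_apply]

/-- The image of `ρ` is the image of `φ` carried by `J_Q ⥲ J_{Q^α} = J_{Q'}`. [cite: MochizukiSemiAnbd2006, Thm 6.8(ii) p.74] -/
theorem rep_range :
    letI := DXs.catK; letI := DYs.catK; letI := DLocObj.dlocCategory X; letI := DLocObj.dlocCategory Y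
    ρ.toHom.toMonoidHom.range =
      φ.toHom.toMonoidHom.range.map
        ((DLocObj.jIso α hI hΔ _).trans (jEquivOfEq _ _ hHQ hNQ).symm).toMulEquiv.toMonoidHom := by
  letI := DXs.catK; letI := DYs.catK; letI := DLocObj.dlocCategory X; letI := DLocObj.dlocCategory Y
  ext y
  constructor
  · rintro ⟨x', rfl⟩
    exact ⟨φ.toHom ((DLocObj.jIso α hI hΔ _).symm (jEquivOfEq _ _ hHP hNP x')), ⟨_, rfl⟩, (hρ x').symm⟩
  · rintro ⟨_, ⟨x, rfl⟩, rfl⟩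
    refine ⟨(jEquivOfEq _ _ hHP hNP).symm (DLocObj.jIso α hI hΔ _ x), ?_⟩
    change ρ.toHom _ = _
    rw [hρ, ContinuousMulEquiv.apply_symm_apply, ContinuousMulEquiv.symm_apply_apply]
    rfl

/-- The image of `ρ` is open of finite index if that of `φ` is (F-type / OF-type clause on images).
[cite: MochizukiGalSect2005, Rmk 2.8.1 p.12] -/
theorem rep_range_open_finiteIndex
    (hopen : letI := DXs.catK; letI := DLocObj.dlocCategory X;
      IsOpen (φ.toHom.toMonoidHom.range : Set (DXs.pi1Functor.obj Q).J))
    (hfi : φ.toHom.toMonoidHom.range.FiniteIndex) :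
    letI := DXs.catK; letI := DYs.catK; letI := DLocObj.dlocCategory X; letI := DLocObj.dlocCategory Y
    IsOpen (ρ.toHom.toMonoidHom.range : Set (DYs.pi1Functor.obj Q').J) ∧
      ρ.toHom.toMonoidHom.range.FiniteIndex := by
  letI := DXs.catK; letI := DYs.catK; letI := DLocObj.dlocCategory X; letI := DLocObj.dlocCategory Y
  rw [rep_range DXs DYs α hI hΔ hHP hNP hHQ hNQ hρ]
  set e := (DLocObj.jIso α hI hΔ (DXs.pi1Functor.obj Q)).trans (jEquivOfEq _ _ hHQ hNQ).symm with he
  refine ⟨?_, ?_⟩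
  · rw [Subgroup.coe_map]
    exact e.toHomeomorph.isOpenMap _ hopen
  · haveI := hfi
    exact ⟨by
      rw [Subgroup.index_map_of_bijective (f := e.toMulEquiv.toMonoidHom) e.bijective]
      exact Subgroup.FiniteIndex.index_ne_zero⟩

end RepProps

end Realize

end Thm68Sub

end Literature.AnabelianGeometry.SemiGraphs

end
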